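import Summits.NavierStokesRegularity.NavierStokesRegularity.Theorems.LerayQuarterDissipationFiniteDissipationLiouvilleVorticityAlignmentTools
import HarnessLib

/-!
# Crux `FiniteDissipationLiouville` (stmt-NavierStokesRegularity-22144): the PLANARITY FLOOR —
# a finite-dissipation Type-I singularity is uniformly NON-TWO-DIMENSIONAL at every scale, in
# every direction

Theorems file of route `LerayQuarterDissipation` (lead prover ns-lqd-lead g8; `--supports` the
crux, line `birth`; portrait facts for the registered stub `stub_envelopeCriticalLiouville`).
Navier–Stokes regularity is NOT proved by anything here; no summit is.

`𝒟_{C,K}`: Type-I ancient mild fields (KNSS gauge, `IsTypeIAncientMild C w`) with the law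
`∫ ‖∇w(s)‖² ≤ K/√(−s)`. The scale-invariant size of a directional derivative is `(−t)‖∂ₑ w(t,x)‖`.

* `slice_eq_zero_of_fderiv_apply_eq_zero` — a member of `𝒟_{C,K}` having ONE slice independent of
  ONE direction (`∂ₑ w(s) ≡ 0`, `e ≠ 0`: a two-dimensional slice) vanishes at that instant (it is
  invariant under translation by `e`, and a continuous `L⁶` field invariant under a nonzero
  translation is zero — `VorticityAlignment.eq_zero_of_memLp_of_translate_invariant`); hence such a
  member is bounded at the apex (`not_singular_of_planar_slice`);
* `false_of_planar_seq` — compactness core: no sequence of SINGULAR members of `𝒟_{C,K}` is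
  asymptotically planar at `t = −1` (`sup_{B(0,k+1)} ‖∂_{e_k} w_k(−1)‖ ≤ 1/(k+1)`, unit `e_k`): the
  directions subconverge on the sphere, the gradients converge pointwise (KNSS compactness), so the
  limit has a two-dimensional slice, which vanishes — contradicting persistence of the singularity;
* `planarity_leaf` — **ONE-SLICE PLANARITY LEAF with `δ = δ(C,K) > 0`**: ONE instant `t < 0` and
  ONE unit direction `e` with `(−t)‖∂ₑ w(t,x)‖ ≤ δ` on the parabolic ball `B(0, δ⁻¹√(−t))` force
  boundedness at the apex;
* `planarity_floor_of_singular` — contrapositive, **a portrait clause of the minimal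
  counterexample: at EVERY instant and in EVERY direction `e` a singular member has a point of
  `B(0, δ⁻¹√(−t))` with `(−t)‖∂ₑ w(t,x)‖ > δ`** — the Koch–Nadirashvili–Seregin–Šverák two-dimensional
  Liouville regime is excluded QUANTITATIVELY and UNIFORMLY IN THE DIRECTION for the residue.

HONEST FRAMING. `δ(C,K)` comes from compactness (no explicit value); portrait fact — no discretely
self-similar scenario with genuinely three-dimensional profile is removed. In the finite-dissipation
class the two-dimensional Liouville theorem itself is not needed: `L⁶` slices make translation
invariance fatal directly.

References: Koch–Nadirashvili–Seregin–Šverák 2009, §4 (compactness) and Thm 5.1 (2D Liouville,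
the regime); Tsai 1998.
-/

noncomputable section

-- the summit and its single sub-problem share the name (CONVENTIONS §1), as in every Theorems file
set_option linter.dupNamespace false

namespace Summit.NavierStokesRegularity.NavierStokesRegularity.Theorems.FiniteDissipationLiouville.Planarity

open MeasureTheory Set Filter Topology Metric Function
open Literature.Analysis Literature.Analysis.FluidPDE
open Summit.NavierStokesRegularity.NavierStokesRegularity.Theorems.FiniteDissipationLiouville
open scoped ENNReal NNReal RealInnerProductSpace

/-! ### A two-dimensional slice vanishes -/

/-- **A member of `𝒟_{C,K}` with ONE slice independent of ONE direction vanishes at that instant**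
(`∂ₑ w(s) ≡ 0` with `e ≠ 0` makes the slice invariant under translation by `e`; a continuous `L⁶`
field invariant under a nonzero translation is zero). [cite: KochNadirashviliSereginSverak2009, Thm 5.1 (arXiv:0709.3599 p. 9)] -/
theorem slice_eq_zero_of_fderiv_apply_eq_zero {C K : ℝ}
    {w : ℝ → EuclideanSpace ℝ (Fin 3) → EuclideanSpace ℝ (Fin 3)}
    (hw : IsTypeIAncientMild C w)
    (hlaw : ∀ s : ℝ, s < 0 → ∫⁻ x, ‖fderiv ℝ (w s) x‖ₑ ^ 2 ≤ ENNReal.ofReal (K / Real.sqrt (-s)))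
    {s : ℝ} (hs : s < 0) {e : EuclideanSpace ℝ (Fin 3)} (he : e ≠ 0)
    (hplanar : ∀ x, fderiv ℝ (w s) x e = 0) : ∀ x, w s x = 0 := by
  have hdiff : Differentiable ℝ (w s) :=
    ((hw.contDiff_slice hs).of_le (WithTop.coe_le_coe.2 le_top) : ContDiff ℝ 1 (w s)).differentiable
      one_ne_zero
  -- invariance under translation by `e`
  have hinv : ∀ x, w s (x + e) = w s x := by
    intro x
    set γ : ℝ → EuclideanSpace ℝ (Fin 3) := fun τ => w s (x + τ • e) with hγ
    have hγd : ∀ τ, HasDerivAt γ (fderiv ℝ (w s) (x + τ • e) ((1 : ℝ) • e)) τ := by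
      intro τ
      have hl : HasDerivAt (fun τ : ℝ => x + τ • e) ((1 : ℝ) • e) τ :=
        ((hasDerivAt_id τ).smul_const e).const_add x
      exact (hdiff (x + τ • e)).hasFDerivAt.comp_hasDerivAt τ hl
    have hγdiff : Differentiable ℝ γ := fun τ => (hγd τ).differentiableAt
    have hγ0 : ∀ τ, deriv γ τ = 0 := fun τ => by
      rw [(hγd τ).deriv, one_smul, hplanar]
    have := is_const_of_deriv_eq_zero hγdiff hγ0 1 0
    simpa [hγ] using this
  obtain ⟨CL, -, hL6⟩ := Birth.memLp_six_slice
  exact VorticityAlignment.eq_zero_of_memLp_of_translate_invariant (hw.contDiff_slice hs).continuous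
    (hL6 C K w hw hlaw s hs).1 he hinv

/-- **A member of `𝒟_{C,K}` with ONE two-dimensional slice is bounded at the apex** (the slice
vanishes; forward uniqueness from the zero slice). [cite: KochNadirashviliSereginSverak2009, Thm 5.1 (arXiv:0709.3599 p. 9)] -/
theorem not_singular_of_planar_slice {C K : ℝ}
    {w : ℝ → EuclideanSpace ℝ (Fin 3) → EuclideanSpace ℝ (Fin 3)}
    (hw : IsTypeIAncientMild C w)
    (hlaw : ∀ s : ℝ, s < 0 → ∫⁻ x, ‖fderiv ℝ (w s) x‖ₑ ^ 2 ≤ ENNReal.ofReal (K / Real.sqrt (-s)))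
    {s : ℝ} (hs : s < 0) {e : EuclideanSpace ℝ (Fin 3)} (he : e ≠ 0)
    (hplanar : ∀ x, fderiv ℝ (w s) x e = 0) :
    ¬ (∀ r > 0, ∀ M : ℝ, ∃ t ∈ Ioo (-(r ^ 2)) (0 : ℝ),
        ∃ x ∈ ball (0 : EuclideanSpace ℝ (Fin 3)) r, M < ‖w t x‖) :=
  CalmSlice.not_singular_of_zero_slice hw hs (slice_eq_zero_of_fderiv_apply_eq_zero hw hlaw hs he hplanar)

/-! ### The compactness core -/

/-- **No sequence of singular members of `𝒟_{C,K}` is asymptotically two-dimensional at `t = −1`**: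
if `‖∂_{e_k} w_k(−1, x)‖ ≤ 1/(k+1)` on `B(0, k+1)` for unit vectors `e_k`, then along a
subsequence `e_k → e` (compact sphere) and the KNSS limit `W` (compactness across members; law and
singularity persist; pointwise convergence of the gradients) has `∂ₑ W(−1) ≡ 0`, so its slice
vanishes — contradiction. [cite: KochNadirashviliSereginSverak2009, §4 (arXiv:0709.3599 p. 8)] -/
theorem false_of_planar_seq {C K : ℝ}
    {w : ℕ → ℝ → EuclideanSpace ℝ (Fin 3) → EuclideanSpace ℝ (Fin 3)}
    (hwk : ∀ k, IsTypeIAncientMild C (w k))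
    (hlaw : ∀ k, ∀ s : ℝ, s < 0 →
      ∫⁻ x, ‖fderiv ℝ (w k s) x‖ₑ ^ 2 ≤ ENNReal.ofReal (K / Real.sqrt (-s)))
    (hsing : ∀ k, ∀ ρ > 0, ∀ M : ℝ, ∃ t ∈ Ioo (-(ρ ^ 2)) (0 : ℝ),
      ∃ x ∈ ball (0 : EuclideanSpace ℝ (Fin 3)) ρ, M < ‖w k t x‖)
    {e : ℕ → EuclideanSpace ℝ (Fin 3)} (he : ∀ k, ‖e k‖ = 1)
    (hplanar : ∀ k : ℕ, ∀ x ∈ ball (0 : EuclideanSpace ℝ (Fin 3)) ((k : ℝ) + 1),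
      ‖fderiv ℝ (w k (-1)) x (e k)‖ ≤ 1 / ((k : ℝ) + 1)) :
    False := by
  obtain ⟨ψ, hψ, W, hW, hunif, -, hgrad⟩ := Compactness.seqLimit hwk
  have hψt : Tendsto ψ atTop atTop := hψ.tendsto_atTop
  have hWlaw : ∀ s : ℝ, s < 0 →
      ∫⁻ x, ‖fderiv ℝ (W s) x‖ₑ ^ 2 ≤ ENNReal.ofReal (K / Real.sqrt (-s)) :=
    Compactness.law_of_seqLimit (Kinf := K) (Kk := fun _ => K) hψt hlaw
      (fun ε hε => Eventually.of_forall fun _ => by linarith) hgrad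
  have hWsing := Compactness.persistent_singularity_seq (w := fun j => w (ψ j))
    (fun j => hwk (ψ j)) (fun j => hlaw (ψ j)) (fun j => hsing (ψ j)) hW hunif
  have h1 : (-1 : ℝ) < 0 := by norm_num
  -- the directions subconverge on the (compact) unit sphere
  have hsph : ∀ j, e (ψ j) ∈ sphere (0 : EuclideanSpace ℝ (Fin 3)) 1 := fun j =>
    mem_sphere_zero_iff_norm.2 (he (ψ j))
  obtain ⟨eL, heL, φ, hφ, hφt⟩ := (isCompact_sphere (0 : EuclideanSpace ℝ (Fin 3)) 1).tendsto_subseq hsph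
  have hφt' : Tendsto φ atTop atTop := hφ.tendsto_atTop
  have heL1 : ‖eL‖ = 1 := mem_sphere_zero_iff_norm.1 heL
  have heL0 : eL ≠ 0 := by
    intro h; rw [h, norm_zero] at heL1; exact zero_ne_one heL1
  -- the limit slice is independent of the direction `eL`
  have hplane : ∀ z, fderiv ℝ (W (-1)) z eL = 0 := by
    intro z
    have hDz : Tendsto (fun j => fderiv ℝ (w (ψ (φ j)) (-1)) z) atTop (𝓝 (fderiv ℝ (W (-1)) z)) :=
      (hgrad (-1) h1 z).comp hφt'
    have happ : Tendsto (fun j => fderiv ℝ (w (ψ (φ j)) (-1)) z (e (ψ (φ j)))) atTop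
        (𝓝 (fderiv ℝ (W (-1)) z eL)) :=
      ((isBoundedBilinearMap_apply (𝕜 := ℝ) (E := EuclideanSpace ℝ (Fin 3))
        (F := EuclideanSpace ℝ (Fin 3))).continuous.tendsto (fderiv ℝ (W (-1)) z, eL)).comp
        (hDz.prodMk_nhds hφt)
    -- the bound `1/(ψ(φ j) + 1) → 0` holds eventually (once `z ∈ B(0, ψ(φ j)+1)`)
    have hR : Tendsto (fun j => (ψ (φ j) : ℝ) + 1) atTop atTop :=
      tendsto_atTop_add_const_right _ 1 (tendsto_natCast_atTop_atTop.comp (hψt.comp hφt'))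
    have hδ : Tendsto (fun j => 1 / ((ψ (φ j) : ℝ) + 1)) atTop (𝓝 0) :=
      (tendsto_one_div_add_atTop_nhds_zero_nat (𝕜 := ℝ)).comp (hψt.comp hφt')
    have hle : ∀ᶠ j in atTop, ‖fderiv ℝ (w (ψ (φ j)) (-1)) z (e (ψ (φ j)))‖ ≤ 1 / ((ψ (φ j) : ℝ) + 1) := by
      filter_upwards [hR.eventually_gt_atTop ‖z‖] with j hj
      exact hplanar (ψ (φ j)) z (mem_ball_zero_iff.2 hj)
    have h0 : Tendsto (fun j => fderiv ℝ (w (ψ (φ j)) (-1)) z (e (ψ (φ j)))) atTop (𝓝 0) :=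
      squeeze_zero_norm' hle hδ
    exact tendsto_nhds_unique happ h0
  exact not_singular_of_planar_slice hW hWlaw h1 heL0 hplane hWsing

/-! ### The one-slice planarity leaf and the planarity floor -/

/-- **ONE-SLICE PLANARITY LEAF.** For all `C, K` there is `δ = δ(C,K) > 0` such that a member of
`𝒟_{C,K}` having ONE instant `t < 0` and ONE unit direction `e` with `(−t)‖∂ₑ w(t,x)‖ ≤ δ` for all
`x` in the parabolic ball `B(0, δ⁻¹√(−t))` is bounded on some backward cylinder at the origin
(scale the instant to `−1`: `RecurrentReductionD.fderiv_nsRescale`; then `false_of_planar_seq`).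
[cite: KochNadirashviliSereginSverak2009, §4 and Thm 5.1 (arXiv:0709.3599 pp. 8–9)] -/
theorem planarity_leaf : ∀ (C K : ℝ), ∃ δ > 0,
    ∀ (w : ℝ → EuclideanSpace ℝ (Fin 3) → EuclideanSpace ℝ (Fin 3)),
      IsTypeIAncientMild C w →
      (∀ s : ℝ, s < 0 → ∫⁻ x, ‖fderiv ℝ (w s) x‖ₑ ^ 2 ≤ ENNReal.ofReal (K / Real.sqrt (-s))) →
      (∃ t < 0, ∃ e : EuclideanSpace ℝ (Fin 3), ‖e‖ = 1 ∧
        ∀ x ∈ ball (0 : EuclideanSpace ℝ (Fin 3)) (δ⁻¹ * Real.sqrt (-t)),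
          (-t) * ‖fderiv ℝ (w t) x e‖ ≤ δ) →
      ¬ (∀ ρ > 0, ∀ M : ℝ, ∃ t ∈ Ioo (-(ρ ^ 2)) (0 : ℝ),
        ∃ x ∈ ball (0 : EuclideanSpace ℝ (Fin 3)) ρ, M < ‖w t x‖) := by
  intro C K
  by_contra hcon
  push Not at hcon
  choose w' hw' hlaw' hq' hsing' using hcon
  choose t' ht' e' he' hq' using hq'
  have hpos : ∀ k : ℕ, (0 : ℝ) < 1 / ((k : ℝ) + 1) := fun k => by positivity
  set w : ℕ → ℝ → EuclideanSpace ℝ (Fin 3) → EuclideanSpace ℝ (Fin 3) :=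
    fun k => w' _ (hpos k) with hw_def
  have hw : ∀ k, IsTypeIAncientMild C (w k) := fun k => hw' _ (hpos k)
  have hlaw := fun k => hlaw' _ (hpos k)
  have hsing := fun k => hsing' _ (hpos k)
  set t : ℕ → ℝ := fun k => t' _ (hpos k) with ht_def
  have ht : ∀ k, t k < 0 := fun k => ht' _ (hpos k)
  set e : ℕ → EuclideanSpace ℝ (Fin 3) := fun k => e' _ (hpos k) with he_def
  have he : ∀ k, ‖e k‖ = 1 := fun k => he' _ (hpos k)
  have hq := fun k => hq' _ (hpos k)
  set c : ℕ → ℝ := fun k => Real.sqrt (-t k) with hc_def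
  have hc : ∀ k, 0 < c k := fun k => Real.sqrt_pos.2 (neg_pos.2 (ht k))
  have hc2 : ∀ k, c k ^ 2 = -t k := fun k => Real.sq_sqrt (neg_nonneg.2 (ht k).le)
  set v : ℕ → ℝ → EuclideanSpace ℝ (Fin 3) → EuclideanSpace ℝ (Fin 3) :=
    fun k => nsRescale (c k) (w k) with hv_def
  have hv : ∀ k, IsTypeIAncientMild C (v k) := fun k => isTypeIAncientMild_nsRescale (hw k) (hc k)
  have hvlaw : ∀ k, ∀ s : ℝ, s < 0 →
      ∫⁻ x, ‖fderiv ℝ (v k s) x‖ₑ ^ 2 ≤ ENNReal.ofReal (K / Real.sqrt (-s)) :=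
    fun k => RecurrentReductionD.dissipationLaw_nsRescale (hlaw k) (hc k)
  have hvsing : ∀ k, ∀ ρ > 0, ∀ M : ℝ, ∃ t ∈ Ioo (-(ρ ^ 2)) (0 : ℝ),
      ∃ x ∈ ball (0 : EuclideanSpace ℝ (Fin 3)) ρ, M < ‖v k t x‖ :=
    fun k => RecurrentReductionD.singularAtOrigin_nsRescale (hsing k) (hc k)
  have e1 : ∀ k, c k ^ 2 * (-1 : ℝ) = t k := fun k => by rw [hc2]; ring
  have hball : ∀ k : ℕ, ∀ z ∈ ball (0 : EuclideanSpace ℝ (Fin 3)) ((k : ℝ) + 1),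
      c k • z ∈ ball (0 : EuclideanSpace ℝ (Fin 3)) ((1 / ((k : ℝ) + 1))⁻¹ * Real.sqrt (-t k)) := by
    intro k z hz
    rw [mem_ball_zero_iff] at hz ⊢
    rw [norm_smul, Real.norm_of_nonneg (hc k).le, one_div, inv_inv, hc_def, mul_comm]
    exact mul_lt_mul_of_pos_right hz (hc k)
  have hplanar : ∀ k : ℕ, ∀ x ∈ ball (0 : EuclideanSpace ℝ (Fin 3)) ((k : ℝ) + 1),
      ‖fderiv ℝ (v k (-1)) x (e k)‖ ≤ 1 / ((k : ℝ) + 1) := by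
    intro k x hx
    rw [hv_def]
    dsimp only
    rw [RecurrentReductionD.fderiv_nsRescale, e1, FunLike.coe_smul, Pi.smul_apply, norm_smul,
      Real.norm_of_nonneg (mul_self_nonneg _), ← sq, hc2]
    exact hq k (c k • x) (hball k x hx)
  exact false_of_planar_seq hv hvlaw hvsing he hplanar

/-- **PLANARITY FLOOR OF A FINITE-DISSIPATION TYPE-I SINGULARITY** (portrait clause of the
registered stub `stub_envelopeCriticalLiouville`): for all `C, K` there is `δ = δ(C,K) > 0` such
that every SINGULAR member of `𝒟_{C,K}` has, at EVERY instant `t < 0` and for EVERY unit direction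
`e`, a point `x ∈ B(0, δ⁻¹√(−t))` with `δ < (−t)‖∂ₑ w(t,x)‖`: near a finite-dissipation Type-I
singularity the flow is uniformly non-two-dimensional, at every scale and in every direction.
[cite: KochNadirashviliSereginSverak2009, §4 and Thm 5.1 (arXiv:0709.3599 pp. 8–9)] -/
theorem planarity_floor_of_singular : ∀ (C K : ℝ), ∃ δ > 0,
    ∀ (w : ℝ → EuclideanSpace ℝ (Fin 3) → EuclideanSpace ℝ (Fin 3)),
      IsTypeIAncientMild C w →
      (∀ s : ℝ, s < 0 → ∫⁻ x, ‖fderiv ℝ (w s) x‖ₑ ^ 2 ≤ ENNReal.ofReal (K / Real.sqrt (-s))) →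
      (∀ ρ > 0, ∀ M : ℝ, ∃ t ∈ Ioo (-(ρ ^ 2)) (0 : ℝ),
        ∃ x ∈ ball (0 : EuclideanSpace ℝ (Fin 3)) ρ, M < ‖w t x‖) →
      ∀ t < 0, ∀ e : EuclideanSpace ℝ (Fin 3), ‖e‖ = 1 →
        ∃ x ∈ ball (0 : EuclideanSpace ℝ (Fin 3)) (δ⁻¹ * Real.sqrt (-t)),
          δ < (-t) * ‖fderiv ℝ (w t) x e‖ := by
  intro C K
  obtain ⟨δ, hδ, h⟩ := planarity_leaf C K
  refine ⟨δ, hδ, fun w hw hlaw hsing t ht e he => ?_⟩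
  by_contra hcon
  push Not at hcon
  exact h w hw hlaw ⟨t, ht, e, he, hcon⟩ hsing

end Summit.NavierStokesRegularity.NavierStokesRegularity.Theorems.FiniteDissipationLiouville.Planarity

end
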